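import Literature.MathematicalPhysics.QuantumFieldTheory.Balaban1983to89.B9Thm310Whole
import Literature.MathematicalPhysics.QuantumFieldTheory.Balaban1983to89.B9Ineq349Whole
import Literature.MathematicalPhysics.QuantumFieldTheory.Balaban1983to89.B6Lemma21Arith

/-!
# `Balaban1983to89.B9RowSum261Faces` — [B9] Theorem 3.7 ∕ Corollary 3.8 ∕ Theorem 3.10 as whole printed leaves at the
# pinned data of `B9Thm37Whole` ∕ `B9Cor38Whole` ∕ `B9Thm310Whole`, with [4] Lemma 2.1 (2.61) SUPPLIED by the family
# schema `B9Ineq349Whole.RowSum261` through THE FREE-EXPONENT DOOR `B6RandomWalkHom.ineq261_of_rowSum_le`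

T. Bałaban, *Propagators for lattice gauge theories in a background field*, Commun. Math. Phys. **99** (1985) 389–434
[`Balaban1985BackgroundPropagators`, "B9"]; [4] = T. Bałaban, *Propagators and renormalization transformations for lattice
gauge theories. II*, Commun. Math. Phys. **96** (1984) 223–250 [`Balaban1984PropagatorsII`].

statement-level skeleton of published theorems with citation tags; proofs where landed; nothing here is a claim about the
Yang–Mills mass gap

WHY THIS FILE.  The N06 faces `B9Thm37Whole.thm37Printed_of_local342` (t37), `B9Cor38Whole.cor38Printed_of_local342` (c38),
`thm37Printed_W38OfOps_of_local342` and `B9Thm310Whole.thm310Printed_of_local3107` (t310) take [4] Lemma 2.1 (2.61) (p. 234: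
*"sup_{y∈𝔅} Σ_{y′∈𝔅} e^{−αδ₀d(y,y′)} ≤ c₁(α), (2.61)"*) as `h261 : ∀ i, M_L ≦ M → B6RandomWalk.Ineq261 d (toB6 (geo i) (R i)
(H i)) δ₀ α` with the PRINTED constant c₁(α) = 12c₀(½α)^d = `B6.c1 d δ₀ α` — refuted AS TYPED in dimension 4 when the
parameter `d` is the dimension (`B6Lemma21Counterexample.printed_c1_exceeded`, GAPS G-A11-1).  But in THESE faces the
parameter `d : ℕ` is FREE (it enters only (2.61) and the constant `B9Thm37Whole.const37 d …`; the majorants of Theorem 3.7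
∕ Corollary 3.8 ∕ Theorem 3.10 carry the block weight (L^jη)², not a kernel weight (L^{j′}η)^{−d}) — and c₀(½α) > 1, so
12c₀(½α)^{d′} exceeds ANY constant for d′ large: the tree's *"DOOR FOR THE REPAIRED CONSTANT"* (`B6RandomWalkHom`,
`ineq261_of_rowSum_le`).  Hence the geometry of record, which supplies (2.61) at every rate with a GENERIC constant
(`B9Ineq349Whole.RowSum261`, from `B6Lemma21ParamKLevelTorus.lemma21_torus_of_cond259`), feeds these faces BY NAME with
`d := d′` — no re-derivation of the Thm 3.7 lineage is needed (contrast: rows 15–16, Theorem 3.9, where `d` IS the kernel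
weight exponent of (3.48) ∕ (3.99) — there the generic-constant re-derivation `B9Thm39WholeGeneric` is the fix).

* §1 the door arithmetic: `one_lt_c0` (c₀(δ₀, α) > 1 for αδ₀ > 0), `exists_le_c1` (∀ c ∃ d′, c ≦ c₁ at parameter d′),
  `exists_le_c1_ge` (the same with d′ ≧ d₀ prescribed), `exists_ineq261_of_rowSum261(_ge)` (`RowSum261 geo` ⇒ ∃ M_L d′, ∀ i,
  M_L ≦ M → `Ineq261 d′ (toB6 (geo i) (R i) (H i)) δ₀ α`).
* §2 the faces fed by `RowSum261 geo` (all other binders VERBATIM as the landed faces; the exponent existential):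
  ★ `thm37Printed_of_rowSum261`, ★ `thm37_cor38_W38OfOps_of_rowSum261` (t37 AND c38 at ONE `W38OfOps` datum),
  `cor38Printed_of_rowSum261`, ★ `thm310Printed_of_rowSum261`.

HONEST SCOPE.  Nothing of [B9] is asserted: Corollary 3.6 for the G′_□ ∕ G_□ (`Local342`, `Local342G`), the structure of the
expansions (`Identities`, `Identities310`), (3.89) (`Factors389`), the static data, sizes, readings and locality inputs remain
HYPOTHESES of printed shape exactly as in the landed faces; (2.61) is consumed from the schema `RowSum261` (a theorem at the
record geometry, n06-i `B9GeoLemma21KLevelV1.rowSum261_geo9Y`).  The constant `const37 d′ …` grows with the door exponent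
d′ — an α-dependent O(1), as every consumer of (2.61) uses it.  Value: kernel-checked bookkeeping; NOT a node discharge;
count-neutral; one finite 𝕋⁴ programme at fixed ε — nothing continuum, nothing about the mass gap.  Cell `pub-ymgap` (HUMAN
RULING D-0062), Track A node N06 [B9], seat `pub-ymgap-dag-n06-j` (successor gen 2), 2026-08-26.
-/

namespace Literature.MathematicalPhysics.QuantumFieldTheory.Balaban1983to89.B9RowSum261Faces

open Literature.MathematicalPhysics.QuantumFieldTheory.Balaban1983to89
open Finset B6RandomWalk B9Thm34Ext B9Thm37Whole B9Cor38Whole B9Thm310Whole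

/-! ## §1 The free-exponent door: `RowSum261` ⇒ the printed-shape (2.61) at SOME parameter d′ -/

section Door

/-- c₀(δ₀, α) = Σ_{z∈ℤ} e^{−αδ₀|z|} > 1 for αδ₀ > 0 (the terms z = 0 and z = 1 already give 1 + e^{−αδ₀}).
[cite: Balaban1984PropagatorsII, p.233 (definition of c₀)] -/
theorem one_lt_c0 {δ₀ α : ℝ} (h : 0 < α * δ₀) : 1 < B6.c0 δ₀ α := by
  unfold B6.c0
  have hs := B6Lemma21Arith.summable_c0_term h
  have h2 : ∑ z ∈ ({0, 1} : Finset ℤ), Real.exp (-(α * δ₀ * |(z : ℝ)|)) ≤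
      ∑' z : ℤ, Real.exp (-(α * δ₀ * |(z : ℝ)|)) :=
    hs.sum_le_tsum _ fun z _ => (Real.exp_pos _).le
  have h01 : ∑ z ∈ ({0, 1} : Finset ℤ), Real.exp (-(α * δ₀ * |(z : ℝ)|)) = 1 + Real.exp (-(α * δ₀)) := by
    rw [Finset.sum_pair (by norm_num : (0 : ℤ) ≠ 1)]
    simp
  have hpos : 0 < Real.exp (-(α * δ₀)) := Real.exp_pos _
  linarith

/-- **The door, quantitative**: for αδ₀ > 0 every real c is below the printed constant c₁ = 12c₀(½α)^{d′} for SOME parameter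
d′ (c₀(½α) > 1, so its powers are unbounded: `pow_unbounded_of_one_lt`). [cite: Balaban1984PropagatorsII, Lemma 2.1 (2.61) p.234] -/
theorem exists_le_c1 (c : ℝ) {δ₀ α : ℝ} (h : 0 < α * δ₀) : ∃ d : ℕ, c ≤ B6.c1 d δ₀ α := by
  have h2 : 0 < α / 2 * δ₀ := by
    have h' : α / 2 * δ₀ = α * δ₀ / 2 := by ring
    rw [h']
    exact half_pos h
  have hc0 : 1 < B6.c0 δ₀ (α / 2) := one_lt_c0 h2
  obtain ⟨n, hn⟩ := pow_unbounded_of_one_lt c hc0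
  refine ⟨n, ?_⟩
  unfold B6.c1
  have hp : 0 ≤ B6.c0 δ₀ (α / 2) ^ n := pow_nonneg (zero_le_one.trans hc0.le) n
  nlinarith

/-- The door with a prescribed lower bound on the exponent (c₁ = 12c₀(½α)^d is nondecreasing in d since c₀(½α) ≧ 1): for every
d₀ there is d ≧ d₀ with c ≦ c₁ at parameter d. [cite: Balaban1984PropagatorsII, Lemma 2.1 (2.61) p.234] -/
theorem exists_le_c1_ge (c : ℝ) (d₀ : ℕ) {δ₀ α : ℝ} (h : 0 < α * δ₀) : ∃ d : ℕ, d₀ ≤ d ∧ c ≤ B6.c1 d δ₀ α := by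
  have h2 : 0 < α / 2 * δ₀ := by
    have h' : α / 2 * δ₀ = α * δ₀ / 2 := by ring
    rw [h']
    exact half_pos h
  have hc0 : 1 < B6.c0 δ₀ (α / 2) := one_lt_c0 h2
  obtain ⟨n, hn⟩ := exists_le_c1 c h
  refine ⟨max n d₀, le_max_right _ _, hn.trans ?_⟩
  unfold B6.c1
  exact mul_le_mul_of_nonneg_left (pow_le_pow_right₀ hc0.le (le_max_left _ _)) (by norm_num)

variable {I : Type} {geo : I → B9.Geometry} [∀ i, Fintype (geo i).Site]

/-- **`RowSum261` THROUGH THE DOOR**: the family schema (2.61)-at-every-rate-with-a-generic-constant (`B9Ineq349Whole.RowSum261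
geo`; p. 234 *"for RM satisfying (2.59)"* = the M-threshold) gives, at the rate αδ₀ > 0, the PRINTED-SHAPE (2.61)
`B6RandomWalk.Ineq261 d′ (toB6 (geo i) (R i) (H i)) δ₀ α` at some parameter d′, for every member above one threshold M_L
(`B6RandomWalkHom.ineq261_of_rowSum_le` + `exists_le_c1`). [cite: Balaban1984PropagatorsII, Lemma 2.1 (2.61) p.234 + (2.59) p.233] -/
theorem exists_ineq261_of_rowSum261 (R : I → ℝ) (H : I → Prop) {δ₀ α : ℝ} (hκ : 0 < α * δ₀)
    (hrow : B9Ineq349Whole.RowSum261 geo) :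
    ∃ (ML : ℝ) (d : ℕ), ∀ i, ML ≤ (geo i).M → Ineq261 d (toB6 (geo i) (R i) (H i)) δ₀ α := by
  obtain ⟨ML, c, h⟩ := hrow (α * δ₀) hκ
  obtain ⟨d, hd⟩ := exists_le_c1 c hκ
  exact ⟨ML, d, fun i hM =>
    B6RandomWalkHom.ineq261_of_rowSum_le (g := toB6 (geo i) (R i) (H i)) d δ₀ α c (h i hM) hd⟩

/-- `exists_ineq261_of_rowSum261` with the exponent bounded below by a prescribed d₀ (e.g. the dimension), for consumers that
want ONE exponent serving several purposes. [cite: Balaban1984PropagatorsII, Lemma 2.1 (2.61) p.234 + (2.59) p.233] -/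
theorem exists_ineq261_of_rowSum261_ge (R : I → ℝ) (H : I → Prop) (d₀ : ℕ) {δ₀ α : ℝ} (hκ : 0 < α * δ₀)
    (hrow : B9Ineq349Whole.RowSum261 geo) :
    ∃ (ML : ℝ) (d : ℕ), d₀ ≤ d ∧ ∀ i, ML ≤ (geo i).M → Ineq261 d (toB6 (geo i) (R i) (H i)) δ₀ α := by
  obtain ⟨ML, c, h⟩ := hrow (α * δ₀) hκ
  obtain ⟨d, hd₀, hd⟩ := exists_le_c1_ge c d₀ hκ
  exact ⟨ML, d, hd₀, fun i hM =>
    B6RandomWalkHom.ineq261_of_rowSum_le (g := toB6 (geo i) (R i) (H i)) d δ₀ α c (h i hM) hd⟩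

end Door

/-! ## §2 The faces of Theorem 3.7 ∕ Corollary 3.8 ∕ Theorem 3.10 fed by `RowSum261` -/

section Faces

variable {I : Type} {c35 : ℝ} {geo : I → B9.Geometry} {bg : I → B9.Backgrounds}
variable [∀ i, Fintype (geo i).Site] [∀ i, DecidableEq (geo i).Site]
variable {X Y ι A : I → Type} [∀ i, Fintype (X i)] [∀ i, DecidableEq (X i)] [∀ i, Fintype (Y i)]
  [∀ i, DecidableEq (Y i)] [∀ i, Fintype (ι i)]

/-- ★ **THEOREM 3.7 AS THE WHOLE PRINTED LEAF, (2.61) SUPPLIED BY `RowSum261`** (p. 409: *"For M sufficiently large, and a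
configuration U satisfying (3.35), the operator G′ can be represented as … (3.90) … The expansion is convergent in all norms
appearing in the inequalities (3.42)–(3.47)."*): `B9Thm37Whole.thm37Printed_of_local342` with its (2.61) input taken through the
door — there is a parameter d′ such that `B9.Thm37Printed c35 geo bg (fun i => E37OfOps (𝔴 i) (𝔬 i) (R i) (H i) (const37 d′ δ₀ α ρ
B₀ N N′ C_ℓ K) ((1 − 2α)δ₀))`.  Needs 0 < α ≦ ½ and 0 < δ₀ (the rate αδ₀ of (2.61) must be positive); every other input
VERBATIM. [cite: Balaban1985BackgroundPropagators, Thm 3.7 (3.90) pp.409–410 + Cor. 3.6 p.408 + (3.35) p.396; Balaban1984PropagatorsII, Lemma 2.1 (2.61) p.234] -/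
theorem thm37Printed_of_rowSum261 (𝔴 : ∀ i, B9.RWExpansion (geo i) (bg i))
    (𝔬 : ∀ i, Ops (geo i) (bg i) (X i) (Y i) (ι i)) (R : I → ℝ) (H : I → Prop) (κ : I → Sizes)
    (α ρ N N' Cℓ K θ₀ B₀ δ₀ a₁ M₁ : ℝ)
    (hc : 0 < c35) (hα : 0 < α) (hα2 : α ≤ 1 / 2) (hN : 0 ≤ N) (hN' : 0 ≤ N') (hCℓ : 1 ≤ Cℓ) (hK : 0 ≤ K)
    (hB₀ : 0 ≤ B₀) (hδ₀ : 0 < δ₀) (ha₁ : 0 < a₁) (hM₁ : 0 < M₁)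
    (hst : ∀ i, StaticOK (𝔬 i) ρ N N' Cℓ (κ i)) (hκ : ∀ i, (κ i).Bounded K θ₀ Cℓ (geo i).M)
    (hrow : B9Ineq349Whole.RowSum261 geo)
    (h36 : ∀ i, M₁ ≤ (geo i).M → ∀ α₀ : ℝ, 0 < α₀ → c35 * (geo i).M * α₀ ≤ a₁ →
      ∀ U : (bg i).Cfg, (bg i).Reg335 c35 α₀ U →
        Local342 (𝔬 i) (R i) (H i) B₀ δ₀ U ∧ Identities (𝔬 i) (R i) (H i) U) :
    ∃ d : ℕ, B9.Thm37Printed c35 geo bg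
      (fun i => E37OfOps (𝔴 i) (𝔬 i) (R i) (H i) (const37 d δ₀ α ρ B₀ N N' Cℓ K) ((1 - 2 * α) * δ₀)) := by
  obtain ⟨ML, d, h261⟩ := exists_ineq261_of_rowSum261 (geo := geo) R H (mul_pos hα hδ₀) hrow
  exact ⟨d, thm37Printed_of_local342 𝔴 𝔬 R H κ d α ρ N N' Cℓ K θ₀ B₀ δ₀ a₁ M₁ ML hc hα.le hα2 hN hN' hCℓ hK hB₀
    hδ₀.le ha₁ hM₁ hst hκ h261 h36⟩

omit [∀ i, Fintype (Y i)] [∀ i, DecidableEq (Y i)] in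
/-- **COROLLARY 3.8 AS THE WHOLE PRINTED LEAF, (2.61) SUPPLIED BY `RowSum261`**: `B9Cor38Whole.cor38Printed_of_local342` through
the door — there is d′ with `B9.Cor38Printed c35 geo bg (fun i => W38OfOps (𝔬 i) (rd i) (R i) (H i) C δ)` (C, δ arbitrary:
Corollary 3.8 does not read the convergence predicate; d′ only enters the O(M^{−1/2}) constant inside the leaf).  Needs 0 < α < 1,
0 < δ₀. [cite: Balaban1985BackgroundPropagators, Cor. 3.8 (3.93)–(3.94) p.410 + Cor. 3.6 p.408; Balaban1984PropagatorsII, Lemma 2.1 (2.61) p.234] -/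
theorem cor38Printed_of_rowSum261 (𝔬 : ∀ i, Ops (geo i) (bg i) (X i) (Y i) (ι i))
    (rd : ∀ i, WalkReading (geo i) (bg i) (X i) (ι i)) (R : I → ℝ) (H : I → Prop) (κ : I → Sizes) (C δ : ℝ)
    (α ρ N N' Cℓ K θ₀ B₀ δ₀ a₁ M₁ : ℝ)
    (hc : 0 < c35) (hα : 0 < α) (hα1 : α < 1) (hθ₀ : 0 ≤ θ₀) (hB₀ : 0 < B₀) (hδ₀ : 0 < δ₀) (ha₁ : 0 < a₁)
    (hM₁ : 0 < M₁)
    (hst : ∀ i, StaticOK (𝔬 i) ρ N N' Cℓ (κ i)) (hκ : ∀ i, (κ i).Bounded K θ₀ Cℓ (geo i).M)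
    (hrd : ∀ i, (rd i).OK (𝔬 i).blk) (hloc : ∀ i, Locality (𝔬 i) (rd i))
    (hrow : B9Ineq349Whole.RowSum261 geo)
    (h36 : ∀ i, M₁ ≤ (geo i).M → ∀ α₀ : ℝ, 0 < α₀ → c35 * (geo i).M * α₀ ≤ a₁ →
      ∀ U : (bg i).Cfg, (bg i).Reg335 c35 α₀ U →
        Local342 (𝔬 i) (R i) (H i) B₀ δ₀ U ∧ Identities (𝔬 i) (R i) (H i) U) :
    B9.Cor38Printed c35 geo bg (fun i => W38OfOps (𝔬 i) (rd i) (R i) (H i) C δ) := by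
  obtain ⟨ML, d, h261⟩ := exists_ineq261_of_rowSum261 (geo := geo) R H (mul_pos hα hδ₀) hrow
  exact cor38Printed_of_local342 𝔬 rd R H κ C δ d α ρ N N' Cℓ K θ₀ B₀ δ₀ a₁ M₁ ML hc hα.le hα1 hθ₀ hB₀ hδ₀ ha₁ hM₁
    hst hκ hrd hloc h261 h36

/-- ★ **ROWS t37 AND c38 AT ONE DATUM, (2.61) SUPPLIED BY `RowSum261`**: Theorem 3.7 and Corollary 3.8 as the whole printed leaves
at the SAME pinned datum `W38OfOps (𝔬 i) (rd i) (R i) (H i) (const37 d′ …) ((1 − 2α)δ₀)` for one door exponent d′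
(`B9Cor38Whole.thm37Printed_W38OfOps_of_local342` + `cor38Printed_of_local342`).  So a knit may pin `(ops x).E37` to ONE walk
datum with the exponent a binder and take t37 ∧ c38 from this conjunction. [cite: Balaban1985BackgroundPropagators, Thm 3.7 (3.90) pp.409–410 + Cor. 3.8 (3.94) p.410; Balaban1984PropagatorsII, Lemma 2.1 (2.61) p.234] -/
theorem thm37_cor38_W38OfOps_of_rowSum261 (𝔬 : ∀ i, Ops (geo i) (bg i) (X i) (Y i) (ι i))
    (rd : ∀ i, WalkReading (geo i) (bg i) (X i) (ι i)) (R : I → ℝ) (H : I → Prop) (κ : I → Sizes)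
    (α ρ N N' Cℓ K θ₀ B₀ δ₀ a₁ M₁ : ℝ)
    (hc : 0 < c35) (hα : 0 < α) (hα2 : α ≤ 1 / 2) (hN : 0 ≤ N) (hN' : 0 ≤ N') (hCℓ : 1 ≤ Cℓ) (hK : 0 ≤ K)
    (hθ₀ : 0 ≤ θ₀) (hB₀ : 0 < B₀) (hδ₀ : 0 < δ₀) (ha₁ : 0 < a₁) (hM₁ : 0 < M₁)
    (hst : ∀ i, StaticOK (𝔬 i) ρ N N' Cℓ (κ i)) (hκ : ∀ i, (κ i).Bounded K θ₀ Cℓ (geo i).M)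
    (hrd : ∀ i, (rd i).OK (𝔬 i).blk) (hloc : ∀ i, Locality (𝔬 i) (rd i))
    (hrow : B9Ineq349Whole.RowSum261 geo)
    (h36 : ∀ i, M₁ ≤ (geo i).M → ∀ α₀ : ℝ, 0 < α₀ → c35 * (geo i).M * α₀ ≤ a₁ →
      ∀ U : (bg i).Cfg, (bg i).Reg335 c35 α₀ U →
        Local342 (𝔬 i) (R i) (H i) B₀ δ₀ U ∧ Identities (𝔬 i) (R i) (H i) U) :
    ∃ d : ℕ,
      B9.Thm37Printed c35 geo bg
        (fun i => W38OfOps (𝔬 i) (rd i) (R i) (H i) (const37 d δ₀ α ρ B₀ N N' Cℓ K) ((1 - 2 * α) * δ₀)) ∧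
      B9.Cor38Printed c35 geo bg
        (fun i => W38OfOps (𝔬 i) (rd i) (R i) (H i) (const37 d δ₀ α ρ B₀ N N' Cℓ K) ((1 - 2 * α) * δ₀)) := by
  obtain ⟨ML, d, h261⟩ := exists_ineq261_of_rowSum261 (geo := geo) R H (mul_pos hα hδ₀) hrow
  exact ⟨d, thm37Printed_W38OfOps_of_local342 𝔬 rd R H κ d α ρ N N' Cℓ K θ₀ B₀ δ₀ a₁ M₁ ML hc hα.le hα2 hN hN' hCℓ
      hK hB₀.le hδ₀.le ha₁ hM₁ hst hκ h261 h36,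
    cor38Printed_of_local342 𝔬 rd R H κ _ _ d α ρ N N' Cℓ K θ₀ B₀ δ₀ a₁ M₁ ML hc hα.le (by linarith) hθ₀ hB₀ hδ₀
      ha₁ hM₁ hst hκ hrd hloc h261 h36⟩

variable [∀ i, Fintype (A i)]

/-- ★ **THEOREM 3.10 AS THE WHOLE PRINTED LEAF, (2.61) SUPPLIED BY `RowSum261`** (pp. 415–416: *"For M sufficiently large, and a
configuration U satisfying (3.35), the operator G has the expansion G = Σ_ω R₀(X₀)R_{α₁}(X₁)·⋯·R_{αₙ}(Xₙ), (3.107) …"*):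
`B9Thm310Whole.thm310Printed_of_local3107` through the door — there is d′ with `B9.Thm310Printed c35 geo bg (fun i => W310OfOps
(𝔬 i) (rd i) (Conv3107 (𝔬 i) (R i) (H i) (const37 d′ δ₀ α ρ B₀ N N′ C_ℓ K) ((1 − 2α)δ₀)))`.  Needs 0 < α ≦ ½, 0 < δ₀; every other
input VERBATIM. [cite: Balaban1985BackgroundPropagators, Thm 3.10 (3.107)–(3.108) pp.415–416 + (3.35) p.396; Balaban1984PropagatorsII, Lemma 2.1 (2.61) p.234] -/
theorem thm310Printed_of_rowSum261 (𝔬 : ∀ i, Ops310 (geo i) (bg i) (X i) (Y i) (ι i) (A i))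
    (rd : ∀ i, WalkReading310 (geo i) (bg i) (X i) (ι i) (A i)) (R : I → ℝ) (H : I → Prop)
    (κ : I → Sizes310) (α ρ N N' NF Cℓ K θ₀ B₀ δ₀ a₁ M₁ : ℝ)
    (hc : 0 < c35) (hα : 0 < α) (hα2 : α ≤ 1 / 2) (hN : 0 ≤ N) (hN' : 0 ≤ N') (hNF : 0 ≤ NF) (hCℓ : 1 ≤ Cℓ)
    (hK : 0 ≤ K) (hθ₀ : 0 ≤ θ₀) (hB₀ : 0 < B₀) (hδ₀ : 0 < δ₀) (ha₁ : 0 < a₁) (hM₁ : 0 < M₁)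
    (hst : ∀ i, StaticOK310 (𝔬 i) ρ N N' NF Cℓ (κ i)) (hκ : ∀ i, (κ i).Bounded K)
    (hrd : ∀ i, (rd i).OK (𝔬 i).blk) (hloc : ∀ i, Locality310 (𝔬 i) (rd i))
    (hrow : B9Ineq349Whole.RowSum261 geo)
    (h36 : ∀ i, M₁ ≤ (geo i).M → ∀ α₀ : ℝ, 0 < α₀ → c35 * (geo i).M * α₀ ≤ a₁ →
      ∀ U : (bg i).Cfg, (bg i).Reg335 c35 α₀ U →
        Local342G (𝔬 i) (R i) (H i) B₀ δ₀ U ∧ B9Thm310Whole.Factors389 (𝔬 i) (R i) (H i) θ₀ δ₀ U ∧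
          Identities310 (𝔬 i) (R i) (H i) U) :
    ∃ d : ℕ, B9.Thm310Printed c35 geo bg
      (fun i => W310OfOps (𝔬 i) (rd i)
        (Conv3107 (𝔬 i) (R i) (H i) (const37 d δ₀ α ρ B₀ N N' Cℓ K) ((1 - 2 * α) * δ₀))) := by
  obtain ⟨ML, d, h261⟩ := exists_ineq261_of_rowSum261 (geo := geo) R H (mul_pos hα hδ₀) hrow
  exact ⟨d, thm310Printed_of_local3107 𝔬 rd R H κ d α ρ N N' NF Cℓ K θ₀ B₀ δ₀ a₁ M₁ ML hc hα.le hα2 hN hN' hNF hCℓ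
    hK hθ₀ hB₀ hδ₀ ha₁ hM₁ hst hκ hrd hloc h261 h36⟩

end Faces

end Literature.MathematicalPhysics.QuantumFieldTheory.Balaban1983to89.B9RowSum261Faces
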